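import Summits.QuantumFields.YangMills.Theorems.LangevinControlUVFemtoCurvatureSkewnessCDominanceBridges

/-!
# Crux `FemtoCurvatureSkewnessC` (stmt-QuantumFields-16205, route `LangevinControlUV`) — BIRTH SKELETON (BC3, `Lines/birth.lean`)

Registrar `planner-skel-stmt-QuantumFields-16205-0` (skeleton-register one-shot, 2026-08-17; route re-audit bin REPAIRABLE).

## What this file certifies
The crux is NOT shredded and NOT a costume: it has a genuine two-piece structure along the seam of its only registered line,
`ratio-transport` (idea card `Cruxes/FemtoCurvatureSkewnessC/Ideas/ratio-transport.md`, skeletons v1–v5 `Lines/Sketch.lean`, dossier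
`Lines/Sketch.md`) — "TRANSPORT, DON'T EVALUATE" the tree-normalised skewness ratio `u = κ₃·G_a/(Cov^{3/2}·G_d)` (`skewRatioT`):

* **(P) `stub_transportEngine : RatioTransportEngineQ`** — the SIGN-FREE engine deliverable (vocabulary (E), `…CRatioTransportDefsE.lean`
  p127471): for compact simple `G`, any `r` and any continuous package map `a₀` — (E_c) some block factor `M ≥ 2` and some continuous positive
  chain map `a` dominated by `a₀` with the TWO-ENDED cutoff transport `CutoffTwoEnded r a M` (a Cauchy property along the `M`-adic RG
  chains, no rate), (E_v) the volume modulus and the large-aspect-ratio Cauchy property of `u` in `a₀`'s femto boxes, (E_s) the separation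
  modulus there.  Convergence / continuity statements only: NO value, NO sign.  (`engineQ_iff`: it is the conjunction of skeleton v4.2's
  three engine stubs, which the line's leads merged into ONE promotable statement because one continuum-limit engine delivers all three.)
* **(A) `stub_anchors : Anchors`** — the line's ONLY SIGNED input (vocabulary (A), `…CRatioTransportDefs.lean` p121740): at every `(G, r)`
  where the crux hypothesis holds, ONE `u₀ > 0` such that on every FIXED torus `L₀ ≥ 8n₀` the ratio is eventually (`β → ∞`) at least `u₀`
  — finite-dimensional Laplace asymptotics on one torus through the toron strata, WITH VALUE (tree value `2^{3/2}d^{-1/2}` exactly;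
  `AnchorsTreeDominance → Anchors`, `…CProfileBridges.lean`).  Fixed lattice only: NO uniformity in the cutoff.
* **`FemtoCurvatureSkewnessC_of : RatioTransportEngineQ → Anchors → FemtoCurvatureSkewnessC`** — sorry-free, concludes the route decl BY
  NAME: the landed rate-free M-adic descent `ratioFloor_of_twoEndedQ` (p128513) turns (A) + (P) into a ratio floor on the femto boxes of
  the HYPOTHESIS map `a₀`; the landed back half `signedRigidity_of_ratioFloor` (p123064) → `skewnessPackage_of_signedRigidity` →
  `femtoCurvatureSkewnessC_iff` (`Iff.rfl`) gives the crux with OUTPUT MAP = `a₀` (continuous and package-carrying by hypothesis).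

Neither piece alone is the crux or the summit: (P) carries no sign (it is consistent with `u ≡ 0`), (A) carries no cutoff-uniformity
(the crux's conclusion lives on femto boxes `L ≤ ℓ₁/a(β) → ∞`, pinned to the hypothesis map's boxes by the landed ruler rigidity
`continuous_package_maps_comparable`; output continuity is load-bearing, `droppingOutputContinuity_iff_eventual`).  BC3 probes
(`stub → FemtoCurvatureSkewnessC`, `stub → YangMills` by `first | exact? | simpa | … | aesop`) are run in the registrar's folder
`bc/stub_transportEngine_probe.lean`, `bc/stub_anchors_probe.lean` over THIS file's imports (all landed bridges visible to `exact?`).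

## Relation to the registered line skeleton v5 (ONE stub `stub_ratioFloorC : RatioFloorC`) — nothing is contradicted
The two stubs here imply v5's single stub (`ratioFloorC_of_engineQ`, landed `…CDominanceBridges.lean` p129932), so this skeleton is a
REFINEMENT of v5 along the line's own seam, not a rival line; the lead's cycle-4 dominance finding stands (ONE fixed-relative-error
statement `PressureDominanceC`, or `RatioFloorC`, closes the crux directly — `femtoCurvatureSkewnessC_of_pressureDominanceC` /
`femtoCurvatureSkewnessC_of_ratioFloorC`, same file — and is the economical item to PROMOTE), and a direct proof of `RatioFloorC` remains
the cheapest way to discharge BOTH stubs' purpose.  A one-stub skeleton cannot serve as a birth certificate (BC3: ≥ 2 named stubs, no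
stub cheaply ≡ the crux — `RatioFloorC → crux` is a landed one-liner for `exact?`), hence this file.

## Disproof used (`Cruxes/FemtoCurvatureSkewnessC/Disproof.lean`, cdisprove gen 1, 2026-08-16T19:27Z)
No `_false_without_` theorem and no `-- Targets` kill is on file.  Load-bearing tokens honoured: OUTPUT continuity (finding 2,
`droppingOutputContinuity_iff_eventual`) — the output map is the hypothesis map `a₀`, continuous by hypothesis, never a wild map;
weak-coupling threshold `β₁` and femto guard (finding 5, `not_exists_allCouplings`, `not_noGuard_of_infrared_zeros`) — both stubs and
`RatioFloor` carry `β`-thresholds and the guard `L·a ≤ ℓ`; `inf Γ₃ > 0` impossible (`not_exists_uniform`) — respected: the floor is on the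
NORMALISED ratio `u`, the resulting `Γ₃ ∝ Γ·√Γ` vanishes at `0⁺`.  Finding 6 (first-pass audit of this very line): A "plausible, not
attackable without a 16204 witness"; E "crux-sized"; joint sufficiency kernel-checked.  Shield `refutationC_needs_twoPointC_witness`:
neither stub is refutable without an instance of the open sibling crux 16204.  Landed Negative lemmas
(`Theorems/FemtoCurvatureSkewnessC/Negative/{ContinuityContent,ClausesAndFreedom}.lean`, imported here through the bridges file):
none has the shape `¬ RatioTransportEngineQ` / `¬ Anchors` or refutes an instance of either.

Layout: § Stubs (the ONLY two `sorry`s of the file) · § Assembly (`FemtoCurvatureSkewnessC_of`, sorry-free; `FemtoCurvatureSkewnessC_skeleton`).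
-/

set_option autoImplicit false

noncomputable section

namespace Summit.QuantumFields.YangMills.Cruxes.FemtoCurvatureSkewnessC.RatioTransport.Birth

open MeasureTheory
open Literature.MathematicalPhysics.QuantumFieldTheory
open Summit.QuantumFields.YangMills.Theses.LangevinControlUV (FemtoCurvatureSkewnessC)
open Summit.QuantumFields.YangMills.Theorems.FemtoCurvatureSkewness (femtoCurvatureSkewnessC_iff)
open Summit.QuantumFields.YangMills.Cruxes.FemtoCurvatureSkewness.CouplingCubicResponse (skewnessPackage_of_signedRigidity)

/-! ## § Stubs — the ONLY two `sorry`s of the file -/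

/-- **Stub (P) `stub_transportEngine` — the sign-free transport engine of line `ratio-transport`** (`RatioTransportEngineQ`,
vocabulary (E) p127471; `↔ CutoffEngineTE ∧ VolumeEngineQ ∧ SeparationEngineQ`, `engineQ_iff`): for compact simple `G`, any `r` and any
CONTINUOUS map `a₀` carrying the two-point package — (E_c) `∃ M ≥ 2, ∃ a` continuous, positive, `Dominated a a₀`, with the two-ended cutoff
transport `CutoffTwoEnded r a M` along the `M`-adic chains of `a`; (E_v) `VolumeModulus r a₀ ∧ VolumeCauchy r a₀`; (E_s)
`SeparationModulus r a₀`.  Every clause is a convergence / uniform-continuity statement for the femto values of the RG-invariant ratio `u`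
(the deliverable of a femto continuum-LIMIT engine with three plaquette insertions; sufficient: `ProfileEngine`, `profileEngine_engineQ`).
Size: programme (Bałaban-class UV stability WITH observables; no printed theorem — dossier `Lines/Sketch.md` § Cycle 5).  Carries NO sign:
consistent with `u ≡ 0`, so it cannot imply the crux alone. -/
theorem stub_transportEngine :
    Summit.QuantumFields.YangMills.Cruxes.FemtoCurvatureSkewnessC.RatioTransport.RatioTransportEngineQ := by
  sorry

/-- **Stub (A) `stub_anchors` — the uniform fixed-torus anchor, the line's only SIGNED input** (`Anchors`, vocabulary (A) p121740): for
compact simple `G` and any `r` at which some continuous unit map carries the two-point package, `FixedTorusAnchors r`: ONE `u₀ > 0` with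
`∀ L₀ ≥ 8n₀ ≥ 8, ∀ᶠ β → ∞, u₀ ≤ skewRatioT r L₀ β n₀`.  Fixed-lattice `β → ∞` Laplace asymptotics around the flat-connection variety,
torons included (tree value of `u` is `2^{3/2}d^{-1/2}` at EVERY `(L₀, n₀)` because `skewRatioT` divides out the exact zero-mode-free torus
propagators; constant modes enter at relative `O((n₀/L₀)⁴) ≤ O(8⁻⁴)`); sufficient: `AnchorsTreeDominance` (`anchors_of_treeDominance`).
Size: L (finite-dimensional but through the toron strata for general `G`; believed true, not in print as a theorem; MC SU(2) `L = 6, 8`: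
`u ≈ 1.4–1.8` vs tree `1.633`).  Carries NO cutoff-uniformity: fixed `L₀` only, so it cannot imply the crux alone (the crux's boxes have
`L → ∞` along every level `n·a(β) = s`, `chain_lower_of_continuous`). -/
theorem stub_anchors :
    Summit.QuantumFields.YangMills.Cruxes.FemtoCurvatureSkewnessC.RatioTransport.Anchors := by
  sorry

/-! ## § Assembly — sorry-free; concludes the route decl BY NAME -/

/-- **The two stubs close the served crux BY NAME** (`Summit.QuantumFields.YangMills.Theses.LangevinControlUV.FemtoCurvatureSkewnessC`).
Given the crux hypothesis at `(G, r)` — a continuous package map `a₀` — take (P)'s engine data at `a₀` (chain map `a`, block factor `M`,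
the two-ended cutoff transport, the volume / separation moduli) and (A)'s uniform anchor at `(G, r)`; the landed rate-free M-adic DESCENT
`ratioFloor_of_twoEndedQ` (p128513: separation rounding by the separation modulus, box rounding by the volume modulus, aspect ratio by the
Cauchy property, ONE two-ended cutoff transport to a coarse point chosen by the intermediate value theorem for `a`, anchor on a finite
family) yields a ratio floor on `a₀`'s femto boxes; the landed BACK HALF — floor ⇒ signed rigidity by `a₀`'s own package
(`signedRigidity_of_ratioFloor`, p123064) ⇒ skewness package (`skewnessPackage_of_signedRigidity`) ⇒ the crux (`femtoCurvatureSkewnessC_iff`,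
`Iff.rfl`) — finishes with OUTPUT MAP = `a₀` (continuous and package-carrying by hypothesis: the output-continuity token is honoured). -/
theorem FemtoCurvatureSkewnessC_of
    (hE : Summit.QuantumFields.YangMills.Cruxes.FemtoCurvatureSkewnessC.RatioTransport.RatioTransportEngineQ)
    (hA : Summit.QuantumFields.YangMills.Cruxes.FemtoCurvatureSkewnessC.RatioTransport.Anchors) :
    FemtoCurvatureSkewnessC := by
  rw [femtoCurvatureSkewnessC_iff]
  intro G _ _ _ _ hG
  letI : MeasurableSpace G := borel G
  haveI : BorelSpace G := ⟨rfl⟩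
  intro r hex
  obtain ⟨a₀, ha₀, hP₀⟩ := hex
  -- (P): the engine data at the hypothesis map `a₀`
  obtain ⟨⟨M, hM, a, ha, hpos, hdom, hcut⟩, ⟨hvm, hvc⟩, hs⟩ := hE G hG r a₀ ha₀ hP₀
  -- positivity of `a₀` is part of its package
  obtain ⟨Γ, β₀, ℓ₀, c, C, -, -, hpos₀, -, -⟩ := id hP₀
  -- (A): the uniform fixed-torus anchor at `(G, r)` (the crux hypothesis holds there, witnessed by `a₀`)
  have hAr : FixedTorusAnchors r := hA G hG r ⟨a₀, ha₀, hP₀⟩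
  -- DESCENT (landed, p128513): anchors + sign-free transports ⇒ a ratio floor on `a₀`'s femto boxes
  have hF : RatioFloor r a₀ := ratioFloor_of_twoEndedQ r a a₀ hM hpos ha hpos₀ hdom hAr hcut hvm hvc hs
  -- BACK HALF (landed, p123064 + sibling line): floor ⇒ signed rigidity ⇒ skewness package; output map := `a₀`
  exact ⟨a₀, ha₀, hP₀, skewnessPackage_of_signedRigidity r hP₀ (signedRigidity_of_ratioFloor r hP₀ hF)⟩

/-- The birth skeleton: the crux modulo exactly the two registered stubs (P) and (A). -/
theorem FemtoCurvatureSkewnessC_skeleton : FemtoCurvatureSkewnessC :=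
  FemtoCurvatureSkewnessC_of stub_transportEngine stub_anchors

end Summit.QuantumFields.YangMills.Cruxes.FemtoCurvatureSkewnessC.RatioTransport.Birth

end
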